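import Literature.AlgebraicGeometry.HodgeTheory.GeneralHodgePropertyDescendsAlongSurjections
import Literature.AlgebraicGeometry.HodgeTheory.SurjectiveMorphismBettiHodgeNumbers
import Literature.AlgebraicGeometry.HodgeTheory.KunnethStandardConjecturePowers
import Literature.AlgebraicGeometry.HodgeTheory.HodgeConjectureDescendsAlongSurjections
import HarnessLib

/-!
# The projections of a product with smooth projective factors are surjective: `GHC`, `HC`, `C`,
# geometric coniveau and the Betti/Hodge numbers pass from `X × Y` and from the powers `X^{m+1}`
# to the factors

Family `hodge`, layer `Literature/AlgebraicGeometry/HodgeTheory`; lane `lit-hodgefound` (Track 2 foundations,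
Layer A1). THEOREMS ONLY (no definition, no named fact; D-0026).

The tree descends, along every SURJECTIVE morphism `g : X ⟶ W` of smooth projective complex varieties
(any relative dimension): the Hodge conjecture (`SurjectiveDescent.hodgeConjectureFor_of_surjective`),
Grothendieck's amended generalized Hodge conjecture (`generalHodgePropertyFor_of_surjective`), the
Künneth standard conjecture (`kunnethComponents_algebraic_of_surjective`), geometric coniveau
(`mem_supportedClasses_of_map_mem_of_surjective'`) and the monotonicity of Betti and Hodge numbers
(`finrank_bettiCohomology_le_of_surjective`, `BettiUniverse.hodgeNumber_hodge_le_of_surjective`) — all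
through Voisin I Lemma 7.28 with the wedge kept. The projections `X × Y → X`, `X × Y → Y` and
`X^{m+1} → X` are surjective as soon as the factors are smooth projective (hence non-empty:
geometrically irreducible), so every one of these statements passes from a product / a power to its
factors (Kahn Lemma 6.30 (2)–(3), Arapura Lemma 4.2: `h(X)` is a direct summand of `h(X × Y)`).

* §1 `IsSmoothProjective.surjective_hom` (`X → Spec ℂ` onto), **`IsSmoothProjective.surjective_fst_left`**,
  **`IsSmoothProjective.surjective_snd_left`** (`pr₁ : X × Y ↠ X` when `Y` is smooth projective, `pr₂`
  symmetrically), **`surjective_powFan_proj_left`** (every projection `X^{m+1} ↠ X`) — reusable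
  `Surjective (…).left` facts for the tree's `[Surjective g.left]` hypotheses.
* §2 `generalHodgePropertyFor_of_tensor_left / _right / _of_powObj` — `GHC(X × Y, i, r) ⟹ GHC(X, i, r)`,
  `GHC(Y, i, r)`; `GHC(X^{m+1}, i, r) ⟹ GHC(X, i, r)`.
* §3 `hodgeConjectureFor_of_tensor_left / _right / _of_powObj` — `HC(X × Y) ⟹ HC(X)`, `HC(X^{m+1}) ⟹ HC(X)`.
* §4 `kunnethComponents_algebraic_of_powObj_self` — `C(X^{m+1}) ⟹ C(X)` (the converse of the tree's
  `kunnethComponents_algebraic_powObj`; `C(X × Y) ⟹ C(X)` is the tree's `KunnethStandardConjectureFactors`).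
* §5 `mem_supportedClasses_left_of_map_fst_mem` / `…_right_of_map_snd_mem`, `mem_algebraicClasses_left_of_map_fst_mem` /
  `…_right_of_map_snd_mem` (the abelian-variety case of the latter is used Summits-side under the name
  `Ring2.Binders.mem_algebraicClasses_of_map_fst_mem`) —
  `pr₁^* x ∈ Nᶜ Hᵏ(X × Y) ⟹ x ∈ Nᶜ Hᵏ(X)` (and algebraic classes).
* §6 `finrank_bettiCohomology_le_tensor_left / _right`, `BettiUniverse.hodgeNumber_hodge_le_tensor_left / _right`,
  `finrank_bettiCohomology_le_powObj`, `BettiUniverse.hodgeNumber_hodge_le_powObj` —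
  `b_k(X) ≤ b_k(X × Y)`, `h^{p,q}(X) ≤ h^{p,q}(X × Y)`, `b_k(X) ≤ b_k(X^{m+1})`, `h^{p,q}(X) ≤ h^{p,q}(X^{m+1})`.

## References

* [Kahn2020] B. Kahn, Zeta and L-functions of varieties and motives, CUP 2020, §6.9 Lemma 6.30 (2)–(3).
* [Arapura2006] D. Arapura, Motivation for Hodge cycles, Adv. Math. 207 (2006), §1 Cor. 1.2, §4 Lemma 4.2.
* [Voisin2002] [VoisinHodgeI2002] C. Voisin, Hodge Theory and Complex Algebraic Geometry I, CUP 2002,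
  §7.3.2 Lemma 7.28, Remark 7.29; §11.3.3 (Künneth components).
* [Hartshorne1977] R. Hartshorne, Algebraic Geometry, Springer 1977, II Thm. 3.3 and Ex. 3.15, III Prop. 10.1.
* [GrothendieckTopology1969] A. Grothendieck, Hodge's general conjecture is false for trivial reasons,
  Topology 8 (1969), pp. 299–301.
-/

noncomputable section

open CategoryTheory CategoryTheory.Limits AlgebraicGeometry MonoidalCategory CartesianMonoidalCategory
open Literature.AlgebraicTopology.SingularHomology
open Literature.AlgebraicGeometry.Motives

namespace Literature.AlgebraicGeometry.HodgeTheory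

variable {n k : ℕ} {X Y : SchemeOver ℂ}

/-! ### §1 The projections of a product with a smooth projective factor are surjective -/

/-- The structure morphism `X → Spec ℂ` of a smooth projective complex variety is surjective (`X` is
geometrically irreducible, hence non-empty). [cite: Hartshorne1977, II Ex. 3.15 and III Prop. 10.1] -/
theorem _root_.Literature.AlgebraicGeometry.Motives.IsSmoothProjective.surjective_hom
    (hX : IsSmoothProjective n X) : Surjective X.hom := by
  haveI := hX.irreducibleSpace
  exact ⟨Function.surjective_to_subsingleton _⟩

/-- **`pr₁ : X × Y ⟶ X` is surjective when `Y` is smooth projective** (base change of the surjective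
`Y → Spec ℂ`). [cite: Hartshorne1977, II Thm. 3.3 and Ex. 3.15] -/
theorem _root_.Literature.AlgebraicGeometry.Motives.IsSmoothProjective.surjective_fst_left (X : SchemeOver ℂ)
    (hY : IsSmoothProjective k Y) : Surjective (fst X Y).left := by
  haveI := hY.surjective_hom
  dsimp
  infer_instance

/-- **`pr₂ : X × Y ⟶ Y` is surjective when `X` is smooth projective.** [cite: Hartshorne1977, II Thm. 3.3 and Ex. 3.15] -/
theorem _root_.Literature.AlgebraicGeometry.Motives.IsSmoothProjective.surjective_snd_left
    (hX : IsSmoothProjective n X) (Y : SchemeOver ℂ) : Surjective (snd X Y).left := by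
  haveI := hX.surjective_hom
  dsimp
  infer_instance

/-- **Every projection `X^{m+1} ⟶ X` of the explicit fibre power `powObj X m` is surjective** (`X` smooth
projective): `pr₀ = fst`, `prᵢ₊₁ = snd ≫ prᵢ` (`powFan_succ_proj_zero`, `powFan_succ_proj_succ`).
[cite: Hartshorne1977, II Thm. 3.3 and Ex. 3.15] -/
theorem surjective_powFan_proj_left (hX : IsSmoothProjective n X) :
    ∀ (m : ℕ) (i : Fin (m + 1)), Surjective ((powFan X m).proj i).left
  | 0, i => by
    rw [powFan_zero_proj]
    change Surjective (𝟙 X.left)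
    infer_instance
  | m + 1, i => by
    refine Fin.cases ?_ (fun j ↦ ?_) i
    · rw [powFan_succ_proj_zero]
      exact (isSmoothProjective_powObj hX m).surjective_fst_left X
    · rw [powFan_succ_proj_succ]
      haveI := hX.surjective_snd_left (powObj X m)
      haveI := surjective_powFan_proj_left hX m j
      change Surjective ((snd X (powObj X m)).left ≫ ((powFan X m).proj j).left)
      infer_instance

/-! ### §2 `GHC` passes from a product and from a power to the factors -/

/-- **`GHC(X × Y, i, r) ⟹ GHC(X, i, r)`** (`pr₁` is surjective; `generalHodgePropertyFor_of_surjective`).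
[cite: Arapura2006, §4 Lemma 4.2 (clause GHC)] [cite: GrothendieckTopology1969, p. 300] -/
theorem generalHodgePropertyFor_of_tensor_left (hX : IsSmoothProjective n X) (hY : IsSmoothProjective k Y)
    {i r : ℕ} (h : GeneralHodgePropertyFor (n + k) (X ⊗ Y) i r) : GeneralHodgePropertyFor n X i r := by
  haveI := hY.surjective_fst_left X
  exact generalHodgePropertyFor_of_surjective (IsSmoothProjective.tensor_holds hX hY) hX (fst X Y) h

/-- **`GHC(X × Y, i, r) ⟹ GHC(Y, i, r)`.** [cite: Arapura2006, §4 Lemma 4.2 (clause GHC)]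
[cite: GrothendieckTopology1969, p. 300] -/
theorem generalHodgePropertyFor_of_tensor_right (hX : IsSmoothProjective n X) (hY : IsSmoothProjective k Y)
    {i r : ℕ} (h : GeneralHodgePropertyFor (n + k) (X ⊗ Y) i r) : GeneralHodgePropertyFor k Y i r := by
  haveI := hX.surjective_snd_left Y
  exact generalHodgePropertyFor_of_surjective (IsSmoothProjective.tensor_holds hX hY) hY (snd X Y) h

/-- **`GHC(X^{m+1}, i, r) ⟹ GHC(X, i, r)`** for the explicit powers `powObj X m` (dimension `n (m+1)`).
[cite: Arapura2006, §4 Lemma 4.2 (clause GHC) and §1 Cor. 1.2] -/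
theorem generalHodgePropertyFor_of_powObj (hX : IsSmoothProjective n X) (m : ℕ) {i r : ℕ}
    (h : GeneralHodgePropertyFor (n * (m + 1)) (powObj X m) i r) : GeneralHodgePropertyFor n X i r := by
  haveI := surjective_powFan_proj_left hX m 0
  exact generalHodgePropertyFor_of_surjective (isSmoothProjective_powObj hX m) hX ((powFan X m).proj 0) h

/-! ### §3 The Hodge conjecture passes from a product and from a power to the factors -/

/-- **`HC(X × Y) ⟹ HC(X)`** (`pr₁` is surjective; `SurjectiveDescent.hodgeConjectureFor_of_surjective`).
[cite: Arapura2006, §4 Lemma 4.2 (clause HC) and §1 Cor. 1.2] [cite: Voisin2002, §7.3.2 Lemma 7.28 and Remark 7.29] -/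
theorem hodgeConjectureFor_of_tensor_left (hX : IsSmoothProjective n X) (hY : IsSmoothProjective k Y)
    (h : HodgeConjectureFor (n + k) (X ⊗ Y)) : HodgeConjectureFor n X := by
  haveI := hY.surjective_fst_left X
  exact SurjectiveDescent.hodgeConjectureFor_of_surjective (IsSmoothProjective.tensor_holds hX hY) hX (fst X Y) h

/-- **`HC(X × Y) ⟹ HC(Y)`.** [cite: Arapura2006, §4 Lemma 4.2 (clause HC) and §1 Cor. 1.2] -/
theorem hodgeConjectureFor_of_tensor_right (hX : IsSmoothProjective n X) (hY : IsSmoothProjective k Y)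
    (h : HodgeConjectureFor (n + k) (X ⊗ Y)) : HodgeConjectureFor k Y := by
  haveI := hX.surjective_snd_left Y
  exact SurjectiveDescent.hodgeConjectureFor_of_surjective (IsSmoothProjective.tensor_holds hX hY) hY (snd X Y) h

/-- **`HC(X^{m+1}) ⟹ HC(X)`** for the explicit powers `powObj X m`. [cite: Arapura2006, §1 Cor. 1.2 and §4 Lemma 4.2] -/
theorem hodgeConjectureFor_of_powObj (hX : IsSmoothProjective n X) (m : ℕ)
    (h : HodgeConjectureFor (n * (m + 1)) (powObj X m)) : HodgeConjectureFor n X := by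
  haveI := surjective_powFan_proj_left hX m 0
  exact SurjectiveDescent.hodgeConjectureFor_of_surjective (isSmoothProjective_powObj hX m) hX
    ((powFan X m).proj 0) h

/-! ### §4 The Künneth standard conjecture passes from a power to the base -/

/-- **`C(X^{m+1}) ⟹ C(X)`** (the projection `X^{m+1} ↠ X` is surjective;
`kunnethComponents_algebraic_of_surjective`) — converse of the tree's `kunnethComponents_algebraic_powObj`.
[cite: Kahn2020, §6.9 Lemma 6.30 (2)–(3)] [cite: Voisin2002, §7.3.2 Lemma 7.28] -/
theorem kunnethComponents_algebraic_of_powObj_self (hX : IsSmoothProjective n X) (m : ℕ)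
    (hC : ∀ (π : Fin (2 * (n * (m + 1)) + 1) → complexBetti (powObj X m ⊗ powObj X m) (2 * (n * (m + 1)))),
      (∀ i : Fin (2 * (n * (m + 1)) + 1), π i ∈ kunnethPiece (powObj X m) (powObj X m)
        (show (2 * (n * (m + 1)) - (i : ℕ)) + i = 2 * (n * (m + 1)) by omega)) →
      ∑ i, π i = diagonalClass (isSmoothProjective_powObj hX m) →
        ∀ i, π i ∈ algebraicClasses (powObj X m ⊗ powObj X m) (n * (m + 1)))
    {πX : Fin (2 * n + 1) → complexBetti (X ⊗ X) (2 * n)}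
    (hπX : ∀ i : Fin (2 * n + 1), πX i ∈ kunnethPiece X X (show (2 * n - (i : ℕ)) + i = 2 * n by omega))
    (hΔX : ∑ i, πX i = diagonalClass hX) (i : Fin (2 * n + 1)) :
    πX i ∈ algebraicClasses (X ⊗ X) n := by
  haveI := surjective_powFan_proj_left hX m 0
  exact kunnethComponents_algebraic_of_surjective (isSmoothProjective_powObj hX m) hX ((powFan X m).proj 0)
    hC hπX hΔX i

/-! ### §5 Geometric coniveau passes from a product to the factors -/

/-- **`pr₁^* x ∈ Nᶜ Hᵏ(X × Y) ⟹ x ∈ Nᶜ Hᵏ(X)`** (coniveau descends along the surjective `pr₁`).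
[cite: Voisin2002, §7.3.2 Lemma 7.28 and Remark 7.29] [cite: Arapura2006, §4 Lemma 4.2] -/
theorem mem_supportedClasses_left_of_map_fst_mem (hX : IsSmoothProjective n X) (hY : IsSmoothProjective k Y)
    {i c : ℕ} {x : complexBetti X i} (hx : complexBetti.map (fst X Y) i x ∈ supportedClasses (X ⊗ Y) i c) :
    x ∈ supportedClasses X i c := by
  haveI := hY.surjective_fst_left X
  exact mem_supportedClasses_of_map_mem_of_surjective' (IsSmoothProjective.tensor_holds hX hY) hX (fst X Y) hx

/-- **`pr₂^* y ∈ Nᶜ Hᵏ(X × Y) ⟹ y ∈ Nᶜ Hᵏ(Y)`.** [cite: Voisin2002, §7.3.2 Lemma 7.28 and Remark 7.29] -/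
theorem mem_supportedClasses_right_of_map_snd_mem (hX : IsSmoothProjective n X) (hY : IsSmoothProjective k Y)
    {i c : ℕ} {y : complexBetti Y i} (hy : complexBetti.map (snd X Y) i y ∈ supportedClasses (X ⊗ Y) i c) :
    y ∈ supportedClasses Y i c := by
  haveI := hX.surjective_snd_left Y
  exact mem_supportedClasses_of_map_mem_of_surjective' (IsSmoothProjective.tensor_holds hX hY) hY (snd X Y) hy

/-- **`pr₁^* x` algebraic on `X × Y` ⟹ `x` algebraic on `X`.** [cite: Voisin2002, §7.3.2 Remark 7.29] -/
theorem mem_algebraicClasses_left_of_map_fst_mem (hX : IsSmoothProjective n X) (hY : IsSmoothProjective k Y)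
    {p : ℕ} {x : complexBetti X (2 * p)}
    (hx : complexBetti.map (fst X Y) (2 * p) x ∈ algebraicClasses (X ⊗ Y) p) : x ∈ algebraicClasses X p :=
  mem_supportedClasses_left_of_map_fst_mem hX hY hx

/-- **`pr₂^* y` algebraic on `X × Y` ⟹ `y` algebraic on `Y`.** [cite: Voisin2002, §7.3.2 Remark 7.29] -/
theorem mem_algebraicClasses_right_of_map_snd_mem (hX : IsSmoothProjective n X) (hY : IsSmoothProjective k Y)
    {p : ℕ} {y : complexBetti Y (2 * p)}
    (hy : complexBetti.map (snd X Y) (2 * p) y ∈ algebraicClasses (X ⊗ Y) p) : y ∈ algebraicClasses Y p :=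
  mem_supportedClasses_right_of_map_snd_mem hX hY hy

/-! ### §6 Betti and Hodge numbers of the factors -/

/-- **`b_i(X) ≤ b_i(X × Y)`** (`pr₁^*` is injective). [cite: Voisin2002, §7.3.2 Lemma 7.28] -/
theorem finrank_bettiCohomology_le_tensor_left (hX : IsSmoothProjective n X) (hY : IsSmoothProjective k Y)
    (i : ℕ) : Module.finrank ℚ (bettiCohomology X i) ≤ Module.finrank ℚ (bettiCohomology (X ⊗ Y) i) := by
  haveI := hY.surjective_fst_left X
  exact finrank_bettiCohomology_le_of_surjective (IsSmoothProjective.tensor_holds hX hY) hX (fst X Y) i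

/-- **`b_i(Y) ≤ b_i(X × Y)`.** [cite: Voisin2002, §7.3.2 Lemma 7.28] -/
theorem finrank_bettiCohomology_le_tensor_right (hX : IsSmoothProjective n X) (hY : IsSmoothProjective k Y)
    (i : ℕ) : Module.finrank ℚ (bettiCohomology Y i) ≤ Module.finrank ℚ (bettiCohomology (X ⊗ Y) i) := by
  haveI := hX.surjective_snd_left Y
  exact finrank_bettiCohomology_le_of_surjective (IsSmoothProjective.tensor_holds hX hY) hY (snd X Y) i

/-- **`h^{p,q}(X) ≤ h^{p,q}(X × Y)`** for the lane's model-free Hodge numbers (`p + q = i`).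
[cite: Voisin2002, §7.3.2 Lemma 7.28] [cite: VoisinHodgeI2002, §7.3.2 (p. 150)] -/
theorem BettiUniverse.hodgeNumber_hodge_le_tensor_left (hHD : exists_isReal_hodgeModel)
    (hX : IsSmoothProjective n X) (hY : IsSmoothProjective k Y) {i p q : ℕ} (hpq : p + q = i) :
    (BettiUniverse.hodge hHD hX i).hodgeNumber p q ≤
      (BettiUniverse.hodge hHD (IsSmoothProjective.tensor_holds hX hY) i).hodgeNumber p q := by
  haveI := hY.surjective_fst_left X
  exact BettiUniverse.hodgeNumber_hodge_le_of_surjective hHD (IsSmoothProjective.tensor_holds hX hY) hX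
    (fst X Y) hpq

/-- **`h^{p,q}(Y) ≤ h^{p,q}(X × Y)`.** [cite: Voisin2002, §7.3.2 Lemma 7.28] [cite: VoisinHodgeI2002, §7.3.2 (p. 150)] -/
theorem BettiUniverse.hodgeNumber_hodge_le_tensor_right (hHD : exists_isReal_hodgeModel)
    (hX : IsSmoothProjective n X) (hY : IsSmoothProjective k Y) {i p q : ℕ} (hpq : p + q = i) :
    (BettiUniverse.hodge hHD hY i).hodgeNumber p q ≤
      (BettiUniverse.hodge hHD (IsSmoothProjective.tensor_holds hX hY) i).hodgeNumber p q := by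
  haveI := hX.surjective_snd_left Y
  exact BettiUniverse.hodgeNumber_hodge_le_of_surjective hHD (IsSmoothProjective.tensor_holds hX hY) hY
    (snd X Y) hpq

/-- **`b_i(X) ≤ b_i(X^{m+1})`.** [cite: Voisin2002, §7.3.2 Lemma 7.28] -/
theorem finrank_bettiCohomology_le_powObj (hX : IsSmoothProjective n X) (m i : ℕ) :
    Module.finrank ℚ (bettiCohomology X i) ≤ Module.finrank ℚ (bettiCohomology (powObj X m) i) := by
  haveI := surjective_powFan_proj_left hX m 0
  exact finrank_bettiCohomology_le_of_surjective (isSmoothProjective_powObj hX m) hX ((powFan X m).proj 0) i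

/-- **`h^{p,q}(X) ≤ h^{p,q}(X^{m+1})`.** [cite: Voisin2002, §7.3.2 Lemma 7.28] [cite: VoisinHodgeI2002, §7.3.2 (p. 150)] -/
theorem BettiUniverse.hodgeNumber_hodge_le_powObj (hHD : exists_isReal_hodgeModel)
    (hX : IsSmoothProjective n X) (m : ℕ) {i p q : ℕ} (hpq : p + q = i) :
    (BettiUniverse.hodge hHD hX i).hodgeNumber p q ≤
      (BettiUniverse.hodge hHD (isSmoothProjective_powObj hX m) i).hodgeNumber p q := by
  haveI := surjective_powFan_proj_left hX m 0
  exact BettiUniverse.hodgeNumber_hodge_le_of_surjective hHD (isSmoothProjective_powObj hX m) hX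
    ((powFan X m).proj 0) hpq

end Literature.AlgebraicGeometry.HodgeTheory

end
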